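import Literature.Barriers.RiemannHypothesis.EpsteinZetaRealZeroLocated
import Literature.Barriers.RiemannHypothesis.EpsteinZetaRealZerosSmallK
import HarnessLib

/-!
# An INTEGRAL interior witness: `ζ_Q(β) = 0` with `0.6 < β < 0.7` for the principal forms of `−248 ≤ d ≤ −232` (barrier audit of `EpsteinZetaRealZeros`, generation 9)

Barrier audit (D-0021, generation 9, 2026-08-17) of the catalogue entry
`Literature.Barriers.RiemannHypothesis.EpsteinZetaRealZeros` through its discharge
`EpsteinZetaRealZerosProofs.lean` (`MontgomeryVaughan2007_epsteinContinuation_holds`, re-checked: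
literally the type of the named fact; axioms `propext`, `Classical.choice`, `Quot.sound`).
Everything in this file is PROVED (theorems only; no definitions, no named facts).

## What the audit adds

The entry's `blocks:` clause lists, besides the exceptional-zero line, "pointwise / interior
non-vanishing on the real axis" arguments, and its in-tree witnesses for zeros AWAY from the two ends
of `(½, 1)` (`realZeros_fill_unit_interval`, `EpsteinZetaRealZeroSweep.lean`) use the NON-INTEGRAL
real forms `x² + c(β)y²`; the integral witnesses proved so far sit at the ends: the Bateman–Grosswald
pair for `k > 7.0556` somewhere in `(½, 1)` (`BatemanGrosswald1964_realZero_holds`), located in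
`(1 − 4/k, 1 − 1/(5k))` only for `k ≥ 50`, i.e. `|d| ≥ 10⁴` (`exists_realZero_located`). This file
supplies the first INTEGRAL witness in the interior, at the scale of the smallest discriminants the
barrier touches:

* `re_completedRiemannZeta₀_lt_sharp` — **`Λ₀(w) < 0.0236` for all real `0 ≤ w ≤ 2`**
  (`Λ₀ = completedRiemannZeta₀`; true range `[0.02303, 0.02360]`), by CONVEXITY of the Mellin
  transform of the non-negative theta kernel (weighted AM–GM `t^{w/2−1} ≤ (1 − w/2)t^{−1} + (w/2)·1`),
  replacing the bound `Λ₀ < 1/20` of generation 8 (`re_completedRiemannZeta₀_lt_twentieth`);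
* `re_thetaΛ_pos_three_fifths`, `re_thetaΛ_neg_seven_tenths` — for `58 ≤ y² ≤ 62` (`y = Im z`),
  **`Re Λ_z(3/5) > 0 > Re Λ_z(7/10)`** (`Λ_z` the completed Epstein zeta function of `ℤz + ℤ`):
  constant term `2y^σΛ(2σ) + 2y^{1−σ}Λ(2 − 2σ)` (`Λ_eq_constantTerm_add_besselPart`) with
  `Λ(6/5) ≥ 25/6`, `Λ(4/5) ≥ −25/4`, `y^{1/5} ≥ 1.5008`, resp. `Λ(7/5) < 0.0236 + 25/14`,
  `Λ(3/5) < 0.0236 − 25/6`, `y^{2/5} ≤ 2.2832`, and `|E_z(σ)| ≤ 10⁻³` for `7 ≤ y ≤ 9`;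
* `exists_realZero_mem_Ioo` — **for a positive definite real form with `58 ≤ k² ≤ 62`
  (`k = √|d|/(2a)`), every analytic continuation of `ζ_Q` vanishes at some real `β ∈ (3/5, 7/10)`**;
* `principalForm_realZero_mem_Ioo`, `realZero_mem_Ioo_disc240`, `realZero_mem_Ioo_disc239`,
  `disc240_continuation_vanishes` — **the principal forms of the nine discriminants
  `−248 ≤ d ≤ −232` (the fundamental `−232, −235, −239, −244, −247, −248` and `−236, −240, −243`;
  e.g. `x² + 60y²`, `d = −240`, `h = 4`) have `ζ_Q(β) = 0` for some `0.6 < β < 0.7`** (numerically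
  `β = 0.664, 0.680, 0.693` for `d = −232, −240, −248`).

So an argument that would prove `Z_Q(σ) ≠ 0` for a FIXED interior abscissa `σ ∈ [0.6, 0.7]` from
properties shared by all ideal-class zeta functions of imaginary quadratic fields — including the
arithmetic ones (integral theta coefficients `r_Q(n)`, weight-one modularity of level `|d|`) that the
non-integral sweep `realZeros_fill_unit_interval` does not test — is refuted by `x² + 60y²`.
What remains without an integral witness (recorded in the entry's `scope_caveats:`): central
vanishing `Z_Q(½) = 0` and a multiple zero on the critical line.

## References

* [BatemanGrosswald1964] P. T. Bateman, E. Grosswald, *On Epstein's zeta function*, Acta Arith. 9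
  (1964), 365–373, Theorem 1 (3)–(5), Theorem 3 (10).
* [LagariasSuzuki2006] J. C. Lagarias, M. Suzuki, *The Riemann hypothesis for certain integrals of
  Eisenstein series*, J. Number Theory 118 (2006), 98–122, Theorems 2–3 (the constant term
  `ζ*(2s)y^s + ζ*(2−2s)y^{1−s}` has exactly two real simple zeros for `y > 4πe^{−γ} = 7.0555…`).
-/

noncomputable section

open Complex Filter Topology MeasureTheory Set HurwitzZeta
open scoped UpperHalfPlane

namespace Literature.Barriers.RiemannHypothesis

open Literature.NumberTheory.Automorphic
open Literature.NumberTheory.LFunctions.RealZeros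

/-! ## Convexity: `Λ₀ < 0.0236` on `[0, 2]` -/

/-- **Convexity of `Λ₀` on the real axis**: `Λ₀(σ) ≤ (1 − σ/2)Λ₀(0) + (σ/2)Λ₀(2)` for `0 ≤ σ ≤ 2`
(`2Λ₀(σ) = ∫₀^∞ t^{σ/2−1}K(t)dt` with `K ≥ 0`, and `t^{σ/2−1} ≤ (1 − σ/2)t^{−1} + (σ/2)t⁰` by the
weighted AM–GM inequality). [folklore] -/
theorem re_completedRiemannZeta₀_le_convexComb {σ : ℝ} (h0 : 0 ≤ σ) (h2 : σ ≤ 2) :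
    (completedRiemannZeta₀ σ).re ≤
      (1 - σ / 2) * (completedRiemannZeta₀ (0 : ℝ)).re + σ / 2 * (completedRiemannZeta₀ (2 : ℝ)).re := by
  rw [re_completedRiemannZeta₀_ofReal, re_completedRiemannZeta₀_ofReal, re_completedRiemannZeta₀_ofReal]
  have hI0 : Integrable (fun t : ℝ ↦ (1 - σ / 2) * (t ^ ((0 : ℝ) / 2 - 1) * kernel t))
      (volume.restrict (Ioi 0)) := (integrableOn_kernel 0).const_mul _
  have hI2 : Integrable (fun t : ℝ ↦ σ / 2 * (t ^ ((2 : ℝ) / 2 - 1) * kernel t))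
      (volume.restrict (Ioi 0)) := (integrableOn_kernel 2).const_mul _
  have hle : ∫ t in Ioi (0 : ℝ), t ^ (σ / 2 - 1) * kernel t ≤
      ∫ t in Ioi (0 : ℝ), ((1 - σ / 2) * (t ^ ((0 : ℝ) / 2 - 1) * kernel t) +
        σ / 2 * (t ^ ((2 : ℝ) / 2 - 1) * kernel t)) := by
    refine setIntegral_mono_on (integrableOn_kernel σ) (hI0.add hI2) measurableSet_Ioi
      (fun t ht ↦ ?_)
    have ht : (0 : ℝ) < t := ht
    have key : t ^ (σ / 2 - 1) ≤
        (1 - σ / 2) * t ^ ((0 : ℝ) / 2 - 1) + σ / 2 * t ^ ((2 : ℝ) / 2 - 1) := by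
      have h := Real.geom_mean_le_arith_mean2_weighted (w₁ := 1 - σ / 2) (w₂ := σ / 2)
        (p₁ := t ^ ((0 : ℝ) / 2 - 1)) (p₂ := t ^ ((2 : ℝ) / 2 - 1)) (by linarith) (by linarith)
        (by positivity) (by positivity) (by ring)
      rw [← Real.rpow_mul ht.le, ← Real.rpow_mul ht.le, ← Real.rpow_add ht] at h
      convert h using 2
      ring
    calc t ^ (σ / 2 - 1) * kernel t
        ≤ ((1 - σ / 2) * t ^ ((0 : ℝ) / 2 - 1) + σ / 2 * t ^ ((2 : ℝ) / 2 - 1)) * kernel t :=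
          mul_le_mul_of_nonneg_right key (kernel_nonneg t)
      _ = _ := by ring
  rw [integral_add hI0 hI2, integral_const_mul, integral_const_mul] at hle
  have e : (1 - σ / 2) * ((∫ t in Ioi (0 : ℝ), t ^ ((0 : ℝ) / 2 - 1) * kernel t) / 2) +
      σ / 2 * ((∫ t in Ioi (0 : ℝ), t ^ ((2 : ℝ) / 2 - 1) * kernel t) / 2) =
      ((1 - σ / 2) * (∫ t in Ioi (0 : ℝ), t ^ ((0 : ℝ) / 2 - 1) * kernel t) +
        σ / 2 * (∫ t in Ioi (0 : ℝ), t ^ ((2 : ℝ) / 2 - 1) * kernel t)) / 2 := by ring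
  rw [e]
  exact div_le_div_of_nonneg_right hle (by norm_num)

/-- **`Re Λ₀(σ) < 0.0236` for real `0 ≤ σ ≤ 2`** (convexity, `Λ₀(0) = Λ₀(1) < 0.0234`,
`Λ₀(2) = π/6 − ½ < 0.0236`; the true range of `Λ₀` on `[0, 2]` is `[0.02303, 0.02360]`). This
sharpens `re_completedRiemannZeta₀_lt_twentieth` (`< 1/20`). [folklore] -/
theorem re_completedRiemannZeta₀_lt_sharp {σ : ℝ} (h0 : 0 ≤ σ) (h2 : σ ≤ 2) :
    (completedRiemannZeta₀ σ).re < 0.0236 := by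
  have hB := re_completedRiemannZeta₀_two_lt_sharp
  rcases eq_or_lt_of_le h2 with rfl | hlt
  · exact hB
  have h := re_completedRiemannZeta₀_le_convexComb h0 h2
  rw [re_completedRiemannZeta₀_zero_eq] at h
  have hA := re_completedRiemannZeta₀_one_lt_sharp
  have w1 : 0 < 1 - σ / 2 := by linarith
  have p1 : (1 - σ / 2) * (completedRiemannZeta₀ (1 : ℝ)).re ≤ (1 - σ / 2) * 0.0234 :=
    mul_le_mul_of_nonneg_left hA.le w1.le
  have p2 : σ / 2 * (completedRiemannZeta₀ (2 : ℝ)).re ≤ σ / 2 * 0.0236 :=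
    mul_le_mul_of_nonneg_left hB.le (by linarith)
  linarith

/-- **`Λ(u) < 0.0236 − 1/u + 1/(u − 1)` for real `1 < u ≤ 2`** (`Λ = Λ₀ − 1/s − 1/(1 − s)`).
[folklore] -/
theorem re_completedRiemannZeta_lt_sharp_of_one_lt {u : ℝ} (h1 : 1 < u) (h2 : u ≤ 2) :
    (completedRiemannZeta u).re < 0.0236 - 1 / u + 1 / (u - 1) := by
  rw [completedRiemannZeta_eq]
  have hE := re_completedRiemannZeta₀_lt_sharp (σ := u) (by linarith) h2
  have hσ : (1 / (u : ℂ)).re = 1 / u := by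
    rw [← Complex.ofReal_one, ← Complex.ofReal_div, Complex.ofReal_re]
  have hσ' : (1 / (1 - (u : ℂ))).re = 1 / (1 - u) := by
    rw [← Complex.ofReal_one, ← Complex.ofReal_sub, ← Complex.ofReal_div, Complex.ofReal_re]
  simp only [sub_re, hσ, hσ']
  have hu : 1 / (1 - u) = -(1 / (u - 1)) := by
    rw [← div_neg, neg_sub]
  rw [hu]
  linarith

/-- **`Λ(u) < 0.0236 − 1/u − 1/(1 − u)` for real `0 < u < 1`.** [folklore] -/
theorem re_completedRiemannZeta_lt_sharp_of_lt_one {u : ℝ} (h0 : 0 < u) (h1 : u < 1) :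
    (completedRiemannZeta u).re < 0.0236 - 1 / u - 1 / (1 - u) := by
  rw [completedRiemannZeta_eq]
  have hE := re_completedRiemannZeta₀_lt_sharp (σ := u) h0.le (by linarith)
  have hσ : (1 / (u : ℂ)).re = 1 / u := by
    rw [← Complex.ofReal_one, ← Complex.ofReal_div, Complex.ofReal_re]
  have hσ' : (1 / (1 - (u : ℂ))).re = 1 / (1 - u) := by
    rw [← Complex.ofReal_one, ← Complex.ofReal_sub, ← Complex.ofReal_div, Complex.ofReal_re]
  simp only [sub_re, hσ, hσ']
  linarith

/-! ## Numerics -/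

/-- `X ≤ Y^q` from `X^n ≤ Y^k`, `q = k/n` (companion of `rpow_le_of_pow_le`). [folklore] -/
theorem le_rpow_of_pow_le {Y X q : ℝ} {k n : ℕ} (hY : 0 ≤ Y) (hX : 0 ≤ X) (hn : n ≠ 0)
    (hq : q * n = k) (h : X ^ n ≤ Y ^ k) : X ≤ Y ^ q := by
  have hn0 : (n : ℝ) ≠ 0 := by exact_mod_cast hn
  have e : Y ^ q = (Y ^ k) ^ ((n : ℝ)⁻¹) := by
    rw [← Real.rpow_natCast Y k, ← Real.rpow_mul hY, ← hq, mul_assoc, mul_inv_cancel₀ hn0, mul_one]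
  rw [e]
  calc X = (X ^ n) ^ ((n : ℝ)⁻¹) := (Real.pow_rpow_inv_natCast hX hn).symm
    _ ≤ (Y ^ k) ^ ((n : ℝ)⁻¹) := Real.rpow_le_rpow (by positivity) h (by positivity)

/-- **The Bessel part is negligible for `7 ≤ y ≤ 9`**: `|E_z(s)| ≤ 48√y e^{−1.4πy} ≤ 10⁻³` on
`−1 ≤ Re s ≤ 2` (`e^{28} ≥ 28⁶/6! > 6·10⁵`). [folklore] -/
theorem norm_epsteinBesselPart_le_of_seven_le (z : ℍ) (hy7 : 7 ≤ z.im) (hy9 : z.im ≤ 9) {s : ℂ}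
    (h1 : -1 ≤ s.re) (h2 : s.re ≤ 2) : ‖epsteinBesselPart z s‖ ≤ 1 / 1000 := by
  have hy1 : 1 ≤ z.im := by linarith
  have hn := norm_epsteinBesselPart_le z hy1 h1 h2
  have hsqrt : Real.sqrt z.im ≤ 3 := by
    rw [Real.sqrt_le_left (by norm_num)]; linarith
  have hexp : Real.exp (-(7 / 5) * Real.pi * z.im) ≤ Real.exp (-28) :=
    Real.exp_le_exp.2 (by nlinarith [Real.pi_gt_three])
  have h28 : Real.exp (-28) ≤ 1 / 600000 := by
    have h := Real.pow_div_factorial_le_exp (28 : ℝ) (by norm_num) 6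
    have h600 : (600000 : ℝ) ≤ Real.exp 28 := by
      refine le_trans ?_ h
      norm_num [Nat.factorial]
    rw [Real.exp_neg, one_div]
    exact inv_anti₀ (by norm_num) h600
  calc ‖epsteinBesselPart z s‖ ≤ 48 * Real.sqrt z.im * Real.exp (-(7 / 5) * Real.pi * z.im) := hn
    _ ≤ 48 * 3 * (1 / 600000) :=
        mul_le_mul (mul_le_mul_of_nonneg_left hsqrt (by norm_num)) (hexp.trans h28)
          (Real.exp_pos _).le (by norm_num)
    _ ≤ 1 / 1000 := by norm_num

/-! ## `58 ≤ y²`: `Λ_z(3/5) > 0` -/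

/-- **`Re Λ_z(3/5) > 0` for `58 ≤ y² ` (`y = Im z ≤ 9`)**: the constant term is
`2y^{2/5}(y^{1/5}Λ(6/5) + Λ(4/5)) ≥ 2(1.5008 · 25/6 − 25/4) > 0.006` and `|E_z| ≤ 10⁻³`
(`58^{1/10} = 1.50087…`, the threshold `y^{1/5} = 3/2` is `y² = 57.67`). [folklore] -/
theorem re_thetaΛ_pos_three_fifths (z : ℍ) (hy : 58 ≤ z.im ^ 2) (hy9 : z.im ≤ 9) :
    0 < ((thetaFEPair z).Λ ((3 / 5 : ℝ) : ℂ)).re := by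
  set y := z.im with hydef
  have hy0 : 0 < y := z.im_pos
  have hy7 : 7 ≤ y := by nlinarith
  have hy1 : 1 ≤ y := by linarith
  set σ : ℝ := 3 / 5 with hσdef
  have hσ0 : (0 : ℝ) < σ := by rw [hσdef]; norm_num
  have hσ1 : σ < 1 := by rw [hσdef]; norm_num
  -- the decomposition at `s = σ`
  have h0 : (σ : ℂ) ≠ 0 := by exact_mod_cast hσ0.ne'
  have h1 : (σ : ℂ) ≠ 1 := by exact_mod_cast hσ1.ne
  have hh : (σ : ℂ) ≠ 1 / 2 := by
    intro h
    have := congrArg Complex.re h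
    simp at this
    linarith
  have hdec := Λ_eq_constantTerm_add_besselPart z hy1 h0 h1 hh
  have eA : (2 * ((y : ℝ) : ℂ) ^ (σ : ℂ) * completedRiemannZeta (2 * (σ : ℂ))).re =
      2 * y ^ σ * (completedRiemannZeta ((2 * σ : ℝ) : ℂ)).re := by
    rw [show (2 : ℂ) * (σ : ℂ) = ((2 * σ : ℝ) : ℂ) by push_cast; ring, ← Complex.ofReal_cpow hy0.le,
      show (2 : ℂ) * ((y ^ σ : ℝ) : ℂ) = ((2 * y ^ σ : ℝ) : ℂ) by push_cast; ring,
      Complex.re_ofReal_mul]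
  have eB : (2 * ((y : ℝ) : ℂ) ^ (1 - (σ : ℂ)) * completedRiemannZeta (2 - 2 * (σ : ℂ))).re =
      2 * y ^ (1 - σ) * (completedRiemannZeta ((2 - 2 * σ : ℝ) : ℂ)).re := by
    rw [show (2 : ℂ) - 2 * (σ : ℂ) = ((2 - 2 * σ : ℝ) : ℂ) by push_cast; ring,
      show (1 : ℂ) - (σ : ℂ) = ((1 - σ : ℝ) : ℂ) by push_cast; ring, ← Complex.ofReal_cpow hy0.le,
      show (2 : ℂ) * ((y ^ (1 - σ) : ℝ) : ℂ) = ((2 * y ^ (1 - σ) : ℝ) : ℂ) by push_cast; ring,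
      Complex.re_ofReal_mul]
  -- numerics in `y`
  have hS : 1.5008 ≤ y ^ (1 / 5 : ℝ) :=
    le_rpow_of_pow_le (q := 1 / 5) (k := 2) (n := 10) hy0.le (by norm_num) (by norm_num)
      (by norm_num) (le_trans (by norm_num) hy)
  have hQ1 : 1 ≤ y ^ (1 - σ) := Real.one_le_rpow hy1 (by rw [hσdef]; norm_num)
  have hPQ : y ^ σ = y ^ (1 - σ) * y ^ (1 / 5 : ℝ) := by
    rw [← Real.rpow_add hy0]; congr 1; rw [hσdef]; norm_num
  -- `Λ(6/5) ≥ 25/6`, `Λ(4/5) ≥ −25/4`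
  have hA : 25 / 6 ≤ (completedRiemannZeta ((2 * σ : ℝ) : ℂ)).re := by
    have hL := re_completedRiemannZeta_ge_of_one_lt (u := 2 * σ) (by rw [hσdef]; norm_num)
    have e1 : 1 / (2 * σ) = 5 / 6 := by rw [hσdef]; norm_num
    have e2 : 1 / (2 * σ - 1) = 5 := by rw [hσdef]; norm_num
    rw [e1, e2] at hL
    linarith
  have hB : -(25 / 4) ≤ (completedRiemannZeta ((2 - 2 * σ : ℝ) : ℂ)).re := by
    have hL := re_completedRiemannZeta_ge_of_lt_one (u := 2 - 2 * σ) (by rw [hσdef]; norm_num)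
      (by rw [hσdef]; norm_num)
    have e1 : 1 / (2 - 2 * σ) = 5 / 4 := by rw [hσdef]; norm_num
    have e2 : 1 / (1 - (2 - 2 * σ)) = 5 := by rw [hσdef]; norm_num
    rw [e1, e2] at hL
    linarith
  -- `E_z(σ) ≥ −10⁻³`
  have hC : -(1 / 1000) ≤ (epsteinBesselPart z σ).re := by
    have hn := norm_epsteinBesselPart_le_of_seven_le z hy7 hy9 (s := (σ : ℂ)) (by simp; linarith)
      (by simp; linarith)
    have hre : -‖epsteinBesselPart z σ‖ ≤ (epsteinBesselPart z σ).re :=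
      (abs_le.1 (Complex.abs_re_le_norm _)).1
    linarith
  rw [hdec, Complex.add_re, Complex.add_re, eA, eB, hPQ]
  set A := (completedRiemannZeta ((2 * σ : ℝ) : ℂ)).re with hAdef
  set B := (completedRiemannZeta ((2 - 2 * σ : ℝ) : ℂ)).re with hBdef
  set Q := y ^ (1 - σ) with hQdef
  set S := y ^ (1 / 5 : ℝ) with hSdef
  have hA0 : 0 ≤ A := by linarith
  have hSA : 1.5008 * A ≤ S * A := mul_le_mul_of_nonneg_right hS hA0
  have hin : 0.003 ≤ S * A + B := by linarith
  have hQin : 1 * (S * A + B) ≤ Q * (S * A + B) := mul_le_mul_of_nonneg_right hQ1 (by linarith)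
  have e : 2 * (Q * S) * A + 2 * Q * B = 2 * (Q * (S * A + B)) := by ring
  linarith

/-! ## `y² ≤ 62`: `Λ_z(7/10) < 0` -/

/-- **`Re Λ_z(7/10) < 0` for `7 ≤ y = Im z`, `y² ≤ 62`**: the constant term is
`2y^{3/10}(y^{2/5}Λ(7/5) + Λ(3/5)) ≤ 2(2.2832(0.0236 + 25/14) + 0.0236 − 25/6) < −0.02` and
`|E_z| ≤ 10⁻³` (`62^{1/5} = 2.2828…`; the threshold is `y² = 62.9`). [folklore] -/
theorem re_thetaΛ_neg_seven_tenths (z : ℍ) (hy7 : 7 ≤ z.im) (hy : z.im ^ 2 ≤ 62) :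
    ((thetaFEPair z).Λ ((7 / 10 : ℝ) : ℂ)).re < 0 := by
  set y := z.im with hydef
  have hy0 : 0 < y := z.im_pos
  have hy1 : 1 ≤ y := by linarith
  have hy9 : y ≤ 9 := by nlinarith
  set σ : ℝ := 7 / 10 with hσdef
  have hσ0 : (0 : ℝ) < σ := by rw [hσdef]; norm_num
  have hσ1 : σ < 1 := by rw [hσdef]; norm_num
  -- the decomposition at `s = σ`
  have h0 : (σ : ℂ) ≠ 0 := by exact_mod_cast hσ0.ne'
  have h1 : (σ : ℂ) ≠ 1 := by exact_mod_cast hσ1.ne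
  have hh : (σ : ℂ) ≠ 1 / 2 := by
    intro h
    have := congrArg Complex.re h
    simp at this
    linarith
  have hdec := Λ_eq_constantTerm_add_besselPart z hy1 h0 h1 hh
  have eA : (2 * ((y : ℝ) : ℂ) ^ (σ : ℂ) * completedRiemannZeta (2 * (σ : ℂ))).re =
      2 * y ^ σ * (completedRiemannZeta ((2 * σ : ℝ) : ℂ)).re := by
    rw [show (2 : ℂ) * (σ : ℂ) = ((2 * σ : ℝ) : ℂ) by push_cast; ring, ← Complex.ofReal_cpow hy0.le,
      show (2 : ℂ) * ((y ^ σ : ℝ) : ℂ) = ((2 * y ^ σ : ℝ) : ℂ) by push_cast; ring,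
      Complex.re_ofReal_mul]
  have eB : (2 * ((y : ℝ) : ℂ) ^ (1 - (σ : ℂ)) * completedRiemannZeta (2 - 2 * (σ : ℂ))).re =
      2 * y ^ (1 - σ) * (completedRiemannZeta ((2 - 2 * σ : ℝ) : ℂ)).re := by
    rw [show (2 : ℂ) - 2 * (σ : ℂ) = ((2 - 2 * σ : ℝ) : ℂ) by push_cast; ring,
      show (1 : ℂ) - (σ : ℂ) = ((1 - σ : ℝ) : ℂ) by push_cast; ring, ← Complex.ofReal_cpow hy0.le,
      show (2 : ℂ) * ((y ^ (1 - σ) : ℝ) : ℂ) = ((2 * y ^ (1 - σ) : ℝ) : ℂ) by push_cast; ring,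
      Complex.re_ofReal_mul]
  -- numerics in `y`
  have hR : y ^ (2 / 5 : ℝ) ≤ 2.2832 :=
    rpow_le_of_pow_le (q := 2 / 5) (k := 2) (n := 5) hy0.le (by norm_num) (by norm_num)
      (by norm_num) (hy.trans (by norm_num))
  have hQ1 : 1 ≤ y ^ (1 - σ) := Real.one_le_rpow hy1 (by rw [hσdef]; norm_num)
  have hPQ : y ^ σ = y ^ (1 - σ) * y ^ (2 / 5 : ℝ) := by
    rw [← Real.rpow_add hy0]; congr 1; rw [hσdef]; norm_num
  -- `Λ(7/5) < 0.0236 + 25/14`, `Λ(3/5) < 0.0236 − 25/6`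
  have hA : (completedRiemannZeta ((2 * σ : ℝ) : ℂ)).re < 0.0236 + 25 / 14 := by
    have hL := re_completedRiemannZeta_lt_sharp_of_one_lt (u := 2 * σ) (by rw [hσdef]; norm_num)
      (by rw [hσdef]; norm_num)
    have e1 : 1 / (2 * σ) = 5 / 7 := by rw [hσdef]; norm_num
    have e2 : 1 / (2 * σ - 1) = 5 / 2 := by rw [hσdef]; norm_num
    rw [e1, e2] at hL
    linarith
  have hB : (completedRiemannZeta ((2 - 2 * σ : ℝ) : ℂ)).re < 0.0236 - 25 / 6 := by
    have hL := re_completedRiemannZeta_lt_sharp_of_lt_one (u := 2 - 2 * σ) (by rw [hσdef]; norm_num)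
      (by rw [hσdef]; norm_num)
    have e1 : 1 / (2 - 2 * σ) = 5 / 3 := by rw [hσdef]; norm_num
    have e2 : 1 / (1 - (2 - 2 * σ)) = 5 / 2 := by rw [hσdef]; norm_num
    rw [e1, e2] at hL
    linarith
  -- `E_z(σ) ≤ 10⁻³`
  have hC : (epsteinBesselPart z σ).re ≤ 1 / 1000 := by
    have hn := norm_epsteinBesselPart_le_of_seven_le z hy7 hy9 (s := (σ : ℂ)) (by simp; linarith)
      (by simp; linarith)
    have hre : (epsteinBesselPart z σ).re ≤ ‖epsteinBesselPart z σ‖ :=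
      (abs_le.1 (Complex.abs_re_le_norm _)).2
    linarith
  rw [hdec, Complex.add_re, Complex.add_re, eA, eB, hPQ]
  set A := (completedRiemannZeta ((2 * σ : ℝ) : ℂ)).re with hAdef
  set B := (completedRiemannZeta ((2 - 2 * σ : ℝ) : ℂ)).re with hBdef
  set Q := y ^ (1 - σ) with hQdef
  set R := y ^ (2 / 5 : ℝ) with hRdef
  have hR0 : 0 ≤ R := by positivity
  have hRA1 : R * A ≤ R * (0.0236 + 25 / 14) := mul_le_mul_of_nonneg_left hA.le hR0
  have hRA2 : R * (0.0236 + 25 / 14) ≤ 2.2832 * (0.0236 + 25 / 14) :=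
    mul_le_mul_of_nonneg_right hR (by norm_num)
  have hin : R * A + B < -0.01 := by linarith
  have hprod : 0 ≤ (Q - 1) * (-(R * A + B)) := mul_nonneg (by linarith) (by linarith)
  have e : 2 * (Q * R) * A + 2 * Q * B = 2 * (Q * (R * A + B)) := by ring
  have e' : (Q - 1) * (-(R * A + B)) = -(Q * (R * A + B)) + (R * A + B) := by ring
  linarith

/-! ## The real zero in `(3/5, 7/10)` -/

variable {a b c : ℝ}

/-- **A real zero of `ζ_Q` in `(0.6, 0.7)` for `58 ≤ k² ≤ 62`.** For a positive definite real form
`Q` with `58 ≤ k² = |d|/(4a²) ≤ 62`, every analytic continuation `Z` of `ζ_Q` has a real zero `β`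
with `3/5 < β < 7/10` (`Λ_{z'}(3/5) > 0 > Λ_{z'}(7/10)`, `Im z' = k`, and the intermediate value
theorem; `Z = c(σ)Λ_{z'}` on `(0, 1)` with `c > 0`). Bateman–Grosswald prove a zero in `(½, 1)` for
`k > 7.0556`; the decile is not printed. [cite: BatemanGrosswald1964, Theorem 3 (10) and p. 367] -/
theorem exists_realZero_mem_Ioo (h : IsPosDefForm a b c) (hk1 : 58 ≤ starkK a b c ^ 2)
    (hk2 : starkK a b c ^ 2 ≤ 62) {Z : ℂ → ℂ} (hZ : IsEpsteinContinuation a b c Z) :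
    ∃ β : ℝ, 3 / 5 < β ∧ β < 7 / 10 ∧ Z β = 0 := by
  obtain ⟨z, hre, him, hk'⟩ := exists_zQ' h
  have hZ' : IsEpsteinContinuation c b a Z := (isEpsteinContinuation_swap_iff a b c Z).2 hZ
  rw [← hk'] at hk1 hk2
  have hy0 : 0 < z.im := z.im_pos
  have hy7 : 7 ≤ z.im := by nlinarith
  have hy9 : z.im ≤ 9 := by nlinarith
  have hpos : 0 < ((thetaFEPair z).Λ ((3 / 5 : ℝ) : ℂ)).re := re_thetaΛ_pos_three_fifths z hk1 hy9
  have hneg : ((thetaFEPair z).Λ ((7 / 10 : ℝ) : ℂ)).re < 0 := re_thetaΛ_neg_seven_tenths z hy7 hk2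
  have h12 : (3 / 5 : ℝ) ≤ 7 / 10 := by norm_num
  have hcont : ContinuousOn (fun σ : ℝ => ((thetaFEPair z).Λ σ).re) (Icc (3 / 5) (7 / 10)) :=
    (continuousOn_re_Λ z (by norm_num : (7 / 10 : ℝ) < 1)).mono (Icc_subset_Icc (by norm_num) le_rfl)
  have hivt := intermediate_value_Icc' h12 hcont
  have h0mem : (0 : ℝ) ∈ Icc ((thetaFEPair z).Λ ((7 / 10 : ℝ) : ℂ)).re
      ((thetaFEPair z).Λ ((3 / 5 : ℝ) : ℂ)).re := ⟨hneg.le, hpos.le⟩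
  obtain ⟨β, hβ, hβ0⟩ := hivt h0mem
  have hβ0 : ((thetaFEPair z).Λ β).re = 0 := hβ0
  have hβ1 : β ≠ 3 / 5 := by
    rintro rfl; rw [hβ0] at hpos; exact lt_irrefl _ hpos
  have hβ2 : β ≠ 7 / 10 := by
    rintro rfl; rw [hβ0] at hneg; exact lt_irrefl _ hneg
  have hlt1 : 3 / 5 < β := lt_of_le_of_ne hβ.1 (Ne.symm hβ1)
  have hlt2 : β < 7 / 10 := lt_of_le_of_ne hβ.2 hβ2
  refine ⟨β, hlt1, hlt2, ?_⟩
  have hβpos : 0 < β := by linarith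
  have hβlt1 : β < 1 := by linarith
  rw [continuation_ofReal_eq h.swap z hre him hZ' hβpos hβlt1, Λ_ofReal_eq_re, hβ0,
    Complex.ofReal_zero, mul_zero]

/-! ## Integral instances: the principal forms of `−248 ≤ d ≤ −232` -/

/-- **The principal form of every discriminant `−248 ≤ d ≤ −232` has `ζ_Q(β) = 0` with
`0.6 < β < 0.7`** (`Q = x² + bxy + cy²`, `|d| = 4c − b²`, `k² = |d|/4 ∈ [58, 62]`; this covers the
fundamental discriminants `−232, −235, −239, −244, −247, −248` and `−236, −240, −243`). [folklore] -/
theorem principalForm_realZero_mem_Ioo {b c : ℝ} (h : IsPosDefForm 1 b c)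
    (hd1 : 232 ≤ 4 * c - b ^ 2) (hd2 : 4 * c - b ^ 2 ≤ 248) {Z : ℂ → ℂ}
    (hZ : IsEpsteinContinuation 1 b c Z) : ∃ β : ℝ, 3 / 5 < β ∧ β < 7 / 10 ∧ Z β = 0 := by
  have hk : starkK 1 b c ^ 2 = (4 * c - b ^ 2) / 4 := by
    rw [starkK_one, div_pow, Real.sq_sqrt (by linarith)]
    norm_num
  exact exists_realZero_mem_Ioo h (by rw [hk]; linarith) (by rw [hk]; linarith) hZ

/-- **`d = −240`: the Epstein zeta function of `x² + 60y²` (class number `4`) vanishes at some real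
`0.6 < β < 0.7`** (numerically `β = 0.680`), for every analytic continuation. [folklore] -/
theorem realZero_mem_Ioo_disc240 {Z : ℂ → ℂ} (hZ : IsEpsteinContinuation 1 0 60 Z) :
    ∃ β : ℝ, 3 / 5 < β ∧ β < 7 / 10 ∧ Z β = 0 :=
  principalForm_realZero_mem_Ioo ⟨one_pos, by norm_num⟩ (by norm_num) (by norm_num) hZ

/-- **`d = −239` (prime, class number `15`): the Epstein zeta function of `x² + xy + 60y²` vanishes
at some real `0.6 < β < 0.7`**, for every analytic continuation. [folklore] -/
theorem realZero_mem_Ioo_disc239 {Z : ℂ → ℂ} (hZ : IsEpsteinContinuation 1 1 60 Z) :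
    ∃ β : ℝ, 3 / 5 < β ∧ β < 7 / 10 ∧ Z β = 0 :=
  principalForm_realZero_mem_Ioo ⟨one_pos, by norm_num⟩ (by norm_num) (by norm_num) hZ

/-- **The audited discharge, instantiated**: the continuation `Z` of `ζ_{x²+60y²}` furnished by
`MontgomeryVaughan2007_epsteinContinuation_holds` (holomorphic off `s = 1`, functional equation
`ξ(s) = ξ(1 − s)`) has a real zero strictly inside `(0.6, 0.7)` — an integral, arithmetic
(CM, weight-one level `240`) violation of the real-axis Riemann hypothesis in the interior of the
critical strip, far from both `½` and `1`. [cite: MontgomeryVaughan2007, §10.1 Exercise 25] -/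
theorem disc240_continuation_vanishes :
    ∃ Z : ℂ → ℂ, IsEpsteinContinuation 1 0 60 Z ∧
      (∀ s : ℂ, (∀ n : ℤ, s ≠ n) → epsteinXi 1 0 60 Z s = epsteinXi 1 0 60 Z (1 - s)) ∧
      ∃ β : ℝ, 3 / 5 < β ∧ β < 7 / 10 ∧ Z β = 0 := by
  obtain ⟨Z, hZ, hFE⟩ := MontgomeryVaughan2007_epsteinContinuation_holds 1 0 60 ⟨one_pos, by norm_num⟩
  exact ⟨Z, hZ, hFE, realZero_mem_Ioo_disc240 hZ⟩

end Literature.Barriers.RiemannHypothesis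

end
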